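import Literature.Analysis.FluidPDE.FluidComputer.RungeKuttaAdvection
import Literature.Analysis.FluidPDE.FluidComputer.RungeKuttaStabilityRegion
import HarnessLib

/-!
# Bridge: `RungeKuttaStabilityRegion`'s written-out statements in the `RungeKutta.R4` / `R3` vocabulary, and the integrating-factor engines' window

HONEST FRAMING (cell `pub-fluidc`, verbatim): *low prior, high value-of-information experiment on Tao's machine
paradigm; NOT a claim that NS blows up.* `RungeKuttaStabilityRegion` (p395582) states the negative-real-axis and
rectangle facts on the polynomials `1 + z + z²/2 + z³/6 + z⁴/24`, `1 + z + z²/2 + z³/6` written out, because at its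
filing the companion `RungeKuttaAdvection` had no build artefact on the farm (it appeared at 09:23Z 2026-08-25). This file
restates the headline facts for `RungeKutta.R4` / `RungeKutta.R3` (pure definitional unfolding — every proof is the
written-out theorem itself) and adds the one corollary that needs both modules: the INTEGRATING-FACTOR engines' linear
window (`integratingFactor_stable`: dns-A IFRK4, dns-B IF-SSP-RK3, opt IF-RK4 are non-amplifying for every `ν ≥ 0`
whenever the advective symbol is in the imaginary-axis window `y² ≤ 8` resp. `y² ≤ 3`). A separate module on purpose:
`RungeKuttaStabilityRegion` stays Mathlib-only. 0 sorry, no named facts. [cite: CanutoEtAl2006, App. D Table D.1]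
-/

noncomputable section

namespace Literature.Analysis.FluidPDE.FluidComputer

namespace RungeKutta

open Complex

/-- `‖R₄(−x)‖ = 1 − x + x²/2 − x³/6 + x⁴/24` for real `x`. [cite: CanutoEtAl2006, App. D Table D.1] -/
theorem norm_R4_neg (x : ℝ) : ‖R4 (-(x : ℂ))‖ = 1 - x + x ^ 2 / 2 - x ^ 3 / 6 + x ^ 4 / 24 :=
  norm_taylor4_neg x

/-- `‖R₃(−x)‖ = |1 − x + x²/2 − x³/6|` for real `x`. [cite: CanutoEtAl2006, App. D Table D.1] -/
theorem norm_R3_neg (x : ℝ) : ‖R3 (-(x : ℂ))‖ = |1 - x + x ^ 2 / 2 - x ^ 3 / 6| :=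
  norm_taylor3_neg x

/-- RK4 on the negative real axis in norm form: `‖R₄(−x)‖ ≤ 1 ⟺ x³ − 4x² + 12x ≤ 24` (`x ≥ 0`).
[cite: CanutoEtAl2006, App. D Table D.1 (RK4 [−2.79, 0])] -/
theorem norm_R4_neg_le_one_iff {x : ℝ} (hx : 0 ≤ x) : ‖R4 (-(x : ℂ))‖ ≤ 1 ↔ x ^ 3 - 4 * x ^ 2 + 12 * x ≤ 24 := by
  rw [norm_R4_neg]; exact R4_neg_le_one_iff hx

/-- RK3 on the negative real axis in norm form: `‖R₃(−x)‖ ≤ 1 ⟺ x³ − 3x² + 6x ≤ 12` (`x ≥ 0`).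
[cite: CanutoEtAl2006, App. D Table D.1 (RK3 [−2.51, 0])] -/
theorem norm_R3_neg_le_one_iff {x : ℝ} (hx : 0 ≤ x) : ‖R3 (-(x : ℂ))‖ ≤ 1 ↔ x ^ 3 - 3 * x ^ 2 + 6 * x ≤ 12 := by
  rw [norm_R3_neg]; exact abs_R3_neg_le_one_iff hx

/-- IFRK4 / IF-SSP-RK3 (dns-A, dns-B, opt kernels) are non-amplifying for every `ν ≥ 0` whenever the advective symbol
is in the imaginary-axis window (`y² ≤ 8` resp. `y² ≤ 3`; sharp at `ν = 0`). [cite: CanutoEtAl2006, App. D Table D.1] -/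
theorem integratingFactor_stable {x y : ℝ} (hx : 0 ≤ x) :
    (y ^ 2 ≤ 8 → ‖((Real.exp (-x) : ℝ) : ℂ) * R4 ((y : ℂ) * I)‖ ≤ 1) ∧
    (y ^ 2 ≤ 3 → ‖((Real.exp (-x) : ℝ) : ℂ) * R3 ((y : ℂ) * I)‖ ≤ 1) :=
  ⟨fun hy => (integratingFactor_norm_le R4 hx y).trans ((norm_R4_imag_le_one_iff y).mpr hy),
   fun hy => (integratingFactor_norm_le R3 hx y).trans ((norm_R3_imag_le_one_iff y).mpr hy)⟩

/-- The rectangle theorem in `R4` form: `‖R₄(−x + iy)‖ ≤ 1` for `0 ≤ x ≤ 2`, `y² ≤ 3`.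
[cite: CanutoEtAl2006, App. D Fig. D.2 (right)] -/
theorem norm_R4_rect_le_one' {x y : ℝ} (hx0 : 0 ≤ x) (hx2 : x ≤ 2) (hy : y ^ 2 ≤ 3) :
    ‖R4 (-(x : ℂ) + (y : ℂ) * I)‖ ≤ 1 :=
  norm_R4_rect_le_one rfl hx0 hx2 hy

/-- The advection–diffusion symbol under the safe viscous rule and the advective window is not amplified by RK4,
`R4` form. [cite: CanutoEtAl2006, App. D §D.1] -/
theorem norm_R4_advection_diffusion_le_one' {ν dt K k₁ k₂ k₃ U₁ U₂ U₃ : ℝ} (hν : 0 ≤ ν) (hdt : 0 ≤ dt)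
    (h₁ : |k₁| ≤ K) (h₂ : |k₂| ≤ K) (h₃ : |k₃| ≤ K) (hsafe : 3 * (ν * K ^ 2 * dt) ≤ 2)
    (hadv : ((U₁ * k₁ + U₂ * k₂ + U₃ * k₃) * dt) ^ 2 ≤ 3) :
    ‖R4 (-((ν * (k₁ ^ 2 + k₂ ^ 2 + k₃ ^ 2) * dt : ℝ) : ℂ)
        + (((U₁ * k₁ + U₂ * k₂ + U₃ * k₃) * dt : ℝ) : ℂ) * I)‖ ≤ 1 :=
  norm_R4_advection_diffusion_le_one hν hdt h₁ h₂ h₃ hsafe hadv rfl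

end RungeKutta

end Literature.Analysis.FluidPDE.FluidComputer

end
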